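import Literature.MathematicalPhysics.QuantumFieldTheory.Balaban1983to89.T4HaarSU2Translate

/-!
# T4HaarSU2LocalDiffeo — LEMMA A on `SU(2)`: a map with injective tangent differential on an open set pushes
# restricted Haar measure to an absolutely continuous measure (pub-balaban, row T4-D.G-EML-K4-LIFT)

Pure measure theory / calculus over Mathlib and the tree's quaternion model of `SU(2)`; no Bałaban content, every
declaration is [folklore].  PURPOSE ONLY (no journal text is typed here): this is the group-level form of LEMMA A of
`T4RadialProjectionAC` (§1 there: a measurable self-map of a finite-dimensional real space with an invertible strict
derivative at every point of an open set `O` pushes `μ|_O` to a measure `≪ μ`), lifted to `SU(2)` through the cone picture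
of Haar measure of `T4HaarSU2Translate` §3 (`Haar(N) = 0 ↔ vol (quatToSU2 ⁻¹' N) = 0`).  It is the map-independent input
"(K4) assembly through the `ℍ`-lift" of the cell record `HOME/b2b-balaban-pv03/EML-HAARAC.md` §5 toward the OPEN off-spine node
`T4ApexTwoLevel.BlockHaarAC F ExpMeanLog.expMeanLogSU` (absolute continuity of the block-averaging push-forward for the
PRINTED exp-mean-log small-loop average of [Balaban1987RG1] (0.4) p. 253 on `SU(2)`): there the one-variable law in the private
bond variable is the EXPLICIT real-analytic self-map `W ↦ exp(Σ_i c_i log(h_i W*)) · W` of the small-field domain (`Σ_i c_i = s < 1`,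
`h_i` the frozen partial holonomies; §1 of that record), with everywhere-injective differential there (certificate (E1)–(E4) of that
record; kernel rows (K1)–(K3) = matrix `exp`/`log` Fréchet calculus), and the present module turns "injective tangent differential
on an open `S ⊆ SU(2)`" into `(Haar|_S).map K ≪ Haar` once and for all, for an ARBITRARY map — the `su2Mean` case
(`T4HaarSU2Translate.haar_map_translateProj_absolutelyContinuous`) had a map given in closed form by `translateProj`.
STATUS (v1.1, docstring only): the map-specific input is in the tree — `T4QuatExpLog` (quaternion model of `exp`/`log`, the
left-trivialised differential of `log`) and `T4EMLFibreAC` (`kD_tangent_injective`; corollary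
`haar_restrict_map_absolutelyContinuous_expMeanLog` = the present main theorem instantiated at that law); v1.1 rewords v1's
"IMPLICIT" (advisory A1 of the consumer-side cross-read `HOME/b2b-balaban-pv03/XREAD-T4HaarSU2LocalDiffeo.md`); no declaration changed.

CONTENT.
* §1 (any real inner product space `E`) Calculus of the radial retraction `y ↦ y/‖y‖` (`hasStrictFDerivAt_inv_norm`,
  `hasStrictFDerivAt_radial`) and of the CONE EXTENSION `y ↦ ‖y‖ • k (y/‖y‖)` of a map `k` (`hasStrictFDerivAt_coneExt`: strict
  derivative `D` at `x ≠ 0` with `D v = k′ v` on `v ⊥ x`); the TANGENCY IDENTITY `⟪F x, D h⟫ = ⟪x, h⟫` for any `F` with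
  `‖F y‖ = ‖y‖` near `x` (`inner_apply_eq_of_norm_eq`: differentiate `‖F‖² = ‖·‖²`, uniqueness of the derivative); hence
  INVERTIBILITY of `D` when `k` takes unit values near `x/‖x‖` and `k′` is injective on `x^⊥` (`exists_equiv_hasStrictFDerivAt_coneExt`).
* §2 (finite-dimensional `E`, additive Haar measure `μ`) LEMMA A IN THE CONE: for an open cone-set `C ∌ 0` and a measurable `F`
  agreeing on `C` with such a cone extension, `μ (C ∩ F ⁻¹' N) = 0` for every null `N` (`measure_inter_preimage_null_of_coneExt`).
* §3 `SU(2)`, quaternion form — MAIN THEOREM `haar_restrict_map_absolutelyContinuous`: `S ⊆ SU(2)` open, `K : SU(2) → SU(2)`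
  measurable, and a map `k : ℍ → ℍ` which at every unit quaternion `u` over `S` (i) has a strict derivative `k′ u`, (ii) agrees
  with `K` (`k u = su2Quat (K (quatToSU2 u))`), (iii) has `k′ u` injective on `u^⊥` ⟹ `((Haar).restrict S).map K ≪ Haar`
  (also for the cell's `HaarData.haar`).
* §4 `SU(2)`, matrix form — `haar_restrict_map_absolutelyContinuous_of_matrix`: the same with the hypotheses stated on an
  ambient map `K♯ : M₂(ℂ) → M₂(ℂ)` (`L²`-operator norm, the cell's standing matrix norm): strict real derivative `D W` at `↑W`
  for `W ∈ S`, `K♯ ↑W = ↑(K W)`, and TANGENT INJECTIVITY `∀ X, Xᴴ = -X → tr X = 0 → D W (↑W * X) = 0 → X = 0`; the reading map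
  `topRowQuat : M₂(ℂ) →L[ℝ] ℍ` (first row) and `quatMatrixCLM` mediate, and the fact that `D W` maps tangent vectors `↑W * X`
  into quaternion matrices is DERIVED (cone identity `quatMatrix ∘ topRowQuat ∘ Φ = Φ` differentiated on the open cone), not assumed.

VALUE = kernel measure theory on `SU(2)` (an engine for a named open node); NOT an estimate of the papers, NOT summit progress.
-/

noncomputable section

open MeasureTheory Set Metric Function Filter
open scoped RealInnerProductSpace Topology ENNReal Pointwise Quaternion

namespace Literature.MathematicalPhysics.QuantumFieldTheory.Balaban1983to89.T4HaarSU2LocalDiffeo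

open T4RadialProjectionAC (hasStrictFDerivAt_norm' measure_inter_preimage_null_of_hasStrictFDerivAt)
open Literature.MathematicalPhysics.QuantumLattice (quatMatrix quatMatrix_apply_00 quatMatrix_apply_01 quatMatrix_apply_10
  quatMatrix_apply_11 quatMatrix_mul quatMatrix_one quatMatrix_smul quatMatrix_neg su2Quat norm_su2Quat su2Quat_ne_zero quatToSU2
  coe_quatToSU2 coe_quatToSU2_of_norm_eq_one quatToSU2_su2Quat quatMatrix_su2Quat measurable_quatToSU2 quatToSU2_smul
  continuousOn_quatToSU2 secondCountableTopology_su2)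
open Literature.Geometry.GaugeTheory (quatMatrix_add quatMatrix_zero quatMatrix_star quatMatrixLinear quatMatrixLinear_apply)
open T4HaarSU2Translate (su2Quat_quatToSU2 measurable_su2Quat continuous_su2Quat haar_null_of_volume_preimage_null
  volume_preimage_quatToSU2_null su2Quat_eq_of_coe_eq haarData_haar_eq)

/-! ## 1. Cone extensions in a real inner product space -/

section Cone

variable {E : Type*} [NormedAddCommGroup E] [InnerProductSpace ℝ E]

/-- `D(‖·‖⁻¹)(x) = -‖x‖⁻² · ⟪x, ·⟫/‖x‖` off `0`. [folklore] -/
theorem hasStrictFDerivAt_inv_norm {x : E} (hx : x ≠ 0) :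
    HasStrictFDerivAt (fun y : E => ‖y‖⁻¹)
      ((ContinuousLinearMap.toSpanSingleton ℝ (-(‖x‖ ^ 2)⁻¹)).comp (‖x‖⁻¹ • innerSL ℝ x)) x :=
  (hasStrictFDerivAt_inv (norm_ne_zero_iff.2 hx)).comp x (hasStrictFDerivAt_norm' hx)

/-- Strict derivative of the RADIAL RETRACTION `y ↦ y/‖y‖` off `0`. [folklore] -/
theorem hasStrictFDerivAt_radial {x : E} (hx : x ≠ 0) :
    HasStrictFDerivAt (fun y : E => ‖y‖⁻¹ • y)
      (‖x‖⁻¹ • ContinuousLinearMap.id ℝ E +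
        ((ContinuousLinearMap.toSpanSingleton ℝ (-(‖x‖ ^ 2)⁻¹)).comp (‖x‖⁻¹ • innerSL ℝ x)).smulRight x) x :=
  (hasStrictFDerivAt_inv_norm hx).fun_smul (hasStrictFDerivAt_id x)

/-- On vectors orthogonal to `x` the derivative of the radial retraction is `v ↦ v/‖x‖`. [folklore] -/
theorem radialDeriv_apply_of_inner_eq_zero {x v : E} (hv : ⟪x, v⟫ = 0) :
    (‖x‖⁻¹ • ContinuousLinearMap.id ℝ E +
        ((ContinuousLinearMap.toSpanSingleton ℝ (-(‖x‖ ^ 2)⁻¹)).comp (‖x‖⁻¹ • innerSL ℝ x)).smulRight x) v =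
      ‖x‖⁻¹ • v := by
  simp [hv]

/-- STRICT DERIVATIVE OF A CONE EXTENSION: if `k` has strict derivative `k′` at `x/‖x‖` (`x ≠ 0`), then `y ↦ ‖y‖ • k (y/‖y‖)`
has a strict derivative `D` at `x` with `D v = k′ v` for every `v ⊥ x`. [folklore] -/
theorem hasStrictFDerivAt_coneExt {k : E → E} {k' : E →L[ℝ] E} {x : E} (hx : x ≠ 0)
    (hk : HasStrictFDerivAt k k' (‖x‖⁻¹ • x)) :
    ∃ D : E →L[ℝ] E, HasStrictFDerivAt (fun y : E => ‖y‖ • k (‖y‖⁻¹ • y)) D x ∧ ∀ v, ⟪x, v⟫ = 0 → D v = k' v := by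
  have h1 := hasStrictFDerivAt_radial hx
  have h2 : HasStrictFDerivAt (fun y : E => k (‖y‖⁻¹ • y)) (k'.comp _) x :=
    HasStrictFDerivAt.comp x (f := fun y : E => ‖y‖⁻¹ • y) hk h1
  refine ⟨_, (hasStrictFDerivAt_norm' hx).fun_smul h2, fun v hv => ?_⟩
  have hn : ‖x‖ ≠ 0 := norm_ne_zero_iff.2 hx
  simp [hv, hn]

/-- TANGENCY IDENTITY: if `F` has derivative `D` at `x` and `‖F y‖ = ‖y‖` near `x`, then `⟪F x, D h⟫ = ⟪x, h⟫` for all `h`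
(differentiate `‖F‖² = ‖·‖²` and use uniqueness of the derivative). [folklore] -/
theorem inner_apply_eq_of_norm_eq {F : E → E} {D : E →L[ℝ] E} {x : E} (hD : HasFDerivAt F D x)
    (heq : ∀ᶠ y in 𝓝 x, ‖F y‖ = ‖y‖) (h : E) : ⟪F x, D h⟫ = ⟪x, h⟫ := by
  have h1 : HasFDerivAt (fun y => ‖F y‖ ^ 2) ((2 • innerSL ℝ (F x)).comp D) x :=
    (hasStrictFDerivAt_norm_sq (F x)).hasFDerivAt.comp x hD
  have h2 : HasFDerivAt (fun y : E => ‖y‖ ^ 2) (2 • innerSL ℝ x) x := (hasStrictFDerivAt_norm_sq x).hasFDerivAt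
  have h3 : (fun y : E => ‖y‖ ^ 2) =ᶠ[𝓝 x] fun y => ‖F y‖ ^ 2 := heq.mono fun y hy => by simp only [hy]
  have h5 : (2 • innerSL ℝ (F x)).comp D = 2 • innerSL ℝ x := (h1.congr_of_eventuallyEq h3).unique h2
  have h6 := congrArg (fun L : E →L[ℝ] ℝ => L h) h5
  simp only [ContinuousLinearMap.comp_apply, two_smul, _root_.add_apply, innerSL_apply_apply] at h6
  linarith

variable [FiniteDimensional ℝ E]

/-- INVERTIBLE DERIVATIVE OF A CONE EXTENSION: if moreover a function `F` agrees with `y ↦ ‖y‖ • k (y/‖y‖)` near `x`, has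
`‖F y‖ = ‖y‖` near `x` (i.e. `k` takes unit values near `x/‖x‖` on the sphere), and `k′` is injective on `x^⊥`, then `F` has an
INVERTIBLE strict derivative at `x` (finite dimension: injective ⇒ invertible). [folklore] -/
theorem exists_equiv_hasStrictFDerivAt_coneExt {F k : E → E} {k' : E →L[ℝ] E} {x : E} (hx : x ≠ 0)
    (hk : HasStrictFDerivAt k k' (‖x‖⁻¹ • x)) (hF : (fun y : E => ‖y‖ • k (‖y‖⁻¹ • y)) =ᶠ[𝓝 x] F)
    (heq : ∀ᶠ y in 𝓝 x, ‖F y‖ = ‖y‖) (hinj : ∀ v, ⟪x, v⟫ = 0 → k' v = 0 → v = 0) :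
    ∃ D : E ≃L[ℝ] E, HasStrictFDerivAt F (D : E →L[ℝ] E) x := by
  obtain ⟨D, hD, hDv⟩ := hasStrictFDerivAt_coneExt hx hk
  have hDF : HasStrictFDerivAt F D x := hD.congr_of_eventuallyEq hF
  have hDinj : Function.Injective D := by
    refine (injective_iff_map_eq_zero D).2 fun v hv => ?_
    have hxv : ⟪x, v⟫ = 0 := by
      have := inner_apply_eq_of_norm_eq hDF.hasFDerivAt heq v
      rw [hv, inner_zero_right] at this
      exact this.symm
    exact hinj v hxv (by rw [← hDv v hxv, hv])
  refine ⟨(LinearEquiv.ofInjectiveEndo D.toLinearMap hDinj).toContinuousLinearEquiv, hDF.congr_fderiv ?_⟩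
  ext v
  rfl

end Cone

/-! ## 2. Lemma A in the cone picture -/

section ConeLemmaA

variable {E : Type*} [NormedAddCommGroup E] [InnerProductSpace ℝ E] [FiniteDimensional ℝ E] [MeasurableSpace E]
  [BorelSpace E] (μ : Measure E) [μ.IsAddHaarMeasure]

/-- **LEMMA A IN THE CONE.** `C` open with `0 ∉ C`; `F` measurable and equal on `C` to the cone extension `y ↦ ‖y‖ • k (y/‖y‖)`
of a map `k` which, at each retracted point `x/‖x‖` (`x ∈ C`), has a strict derivative `k′ x`, unit norm, and `k′ x` injective on
`x^⊥`.  Then `C ∩ F⁻¹(N)` is `μ`-null for every `μ`-null measurable `N`. [folklore] -/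
theorem measure_inter_preimage_null_of_coneExt {C : Set E} (hC : IsOpen C) (hC0 : (0 : E) ∉ C) {F : E → E}
    (hFm : Measurable F) {k : E → E} {k' : E → E →L[ℝ] E} (hFk : ∀ x ∈ C, F x = ‖x‖ • k (‖x‖⁻¹ • x))
    (hk : ∀ x ∈ C, HasStrictFDerivAt k (k' x) (‖x‖⁻¹ • x)) (hsph : ∀ x ∈ C, ‖k (‖x‖⁻¹ • x)‖ = 1)
    (hinj : ∀ x ∈ C, ∀ v, ⟪x, v⟫ = 0 → k' x v = 0 → v = 0) {N : Set E} (hN : MeasurableSet N) (hμN : μ N = 0) :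
    μ (C ∩ F ⁻¹' N) = 0 := by
  have key : ∀ x ∈ C, ∃ D : E ≃L[ℝ] E, HasStrictFDerivAt F (D : E →L[ℝ] E) x := by
    intro x hx
    have hx0 : x ≠ 0 := fun h => hC0 (h ▸ hx)
    have hCx : C ∈ 𝓝 x := hC.mem_nhds hx
    refine exists_equiv_hasStrictFDerivAt_coneExt hx0 (hk x hx) ?_ ?_ (hinj x hx)
    · exact Filter.eventually_of_mem hCx fun y hy => (hFk y hy).symm
    · exact Filter.eventually_of_mem hCx fun y hy => by rw [hFk y hy, norm_smul, norm_norm, hsph y hy, mul_one]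
  choose! D hD using key
  exact measure_inter_preimage_null_of_hasStrictFDerivAt μ hC hN hFm (f' := D) hD hμN

end ConeLemmaA

/-! ## 3. `SU(2)`: quaternion form of the main theorem -/

section SU2

attribute [local instance] Literature.Analysis.FluidPDE.Tao2016.quatMeasurableSpace
  Literature.Analysis.FluidPDE.Tao2016.quatBorelSpace

attribute [local instance] Literature.MathematicalPhysics.QuantumLattice.secondCountableTopology_su2

/-- The open cone over an open `S ⊆ SU(2)`: `{x ≠ 0 | quatToSU2 x ∈ S}` is open in `ℍ`. [folklore] -/
theorem isOpen_cone {S : Set (Matrix.specialUnitaryGroup (Fin 2) ℂ)} (hS : IsOpen S) :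
    IsOpen ({(0 : ℍ)}ᶜ ∩ quatToSU2 ⁻¹' S) :=
  continuousOn_quatToSU2.isOpen_inter_preimage isOpen_compl_singleton hS

/-- **MAIN THEOREM (quaternion form): LEMMA A ON `SU(2)`.**  Let `S ⊆ SU(2)` be open and `K : SU(2) → SU(2)` measurable.  Suppose a
map `k : ℍ → ℍ` satisfies, at every UNIT quaternion `u` with `quatToSU2 u ∈ S`: (i) `k` has a strict (real Fréchet) derivative
`k′ u` at `u`; (ii) `k u = su2Quat (K (quatToSU2 u))` (`k` represents `K` on the unit sphere over `S`); (iii) TANGENT INJECTIVITY: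
`k′ u v = 0` with `v ⊥ u` forces `v = 0`.  Then the push-forward of Haar measure restricted to `S` is absolutely continuous:
`((Haar).restrict S).map K ≪ Haar`.  (Cone criterion for Haar-null sets; on the open cone over `S` the globally measurable map
`x ↦ ‖x‖ • su2Quat (K (quatToSU2 x))` is the cone extension of `k`, with invertible strict derivative by §1; Lemma A.) [folklore] -/
theorem haar_restrict_map_absolutelyContinuous {S : Set (Matrix.specialUnitaryGroup (Fin 2) ℂ)} (hS : IsOpen S)
    {K : Matrix.specialUnitaryGroup (Fin 2) ℂ → Matrix.specialUnitaryGroup (Fin 2) ℂ} (hK : Measurable K)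
    {k : ℍ → ℍ} {k' : ℍ → ℍ →L[ℝ] ℍ}
    (hk : ∀ u : ℍ, ‖u‖ = 1 → quatToSU2 u ∈ S → HasStrictFDerivAt k (k' u) u)
    (hkK : ∀ u : ℍ, ‖u‖ = 1 → quatToSU2 u ∈ S → k u = su2Quat (K (quatToSU2 u)))
    (hinj : ∀ u : ℍ, ‖u‖ = 1 → quatToSU2 u ∈ S → ∀ v : ℍ, ⟪u, v⟫ = 0 → k' u v = 0 → v = 0) :
    ((haarProbability (Matrix.specialUnitaryGroup (Fin 2) ℂ)).restrict S).map K ≪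
      haarProbability (Matrix.specialUnitaryGroup (Fin 2) ℂ) := by
  refine Measure.AbsolutelyContinuous.mk fun N hN h0 => ?_
  rw [Measure.map_apply hK hN, Measure.restrict_apply (hK hN)]
  have hmeas : MeasurableSet (K ⁻¹' N ∩ S) := (hK hN).inter hS.measurableSet
  refine haar_null_of_volume_preimage_null hmeas ?_
  set C : Set ℍ := {(0 : ℍ)}ᶜ ∩ quatToSU2 ⁻¹' S with hC_def
  have hC : IsOpen C := isOpen_cone hS
  have hC0 : (0 : ℍ) ∉ C := fun h => h.1 rfl
  set F : ℍ → ℍ := fun x => ‖x‖ • su2Quat (K (quatToSU2 x)) with hF_def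
  have hFm : Measurable F := measurable_norm.smul (measurable_su2Quat.comp (hK.comp measurable_quatToSU2))
  have hN' : MeasurableSet (quatToSU2 ⁻¹' N) := measurable_quatToSU2 hN
  have hvN' : (volume : Measure ℍ) (quatToSU2 ⁻¹' N) = 0 := volume_preimage_quatToSU2_null hN h0
  -- the unit vector of a cone point
  have hunit : ∀ x ∈ C, ‖‖x‖⁻¹ • x‖ = 1 := fun x hx => by
    rw [norm_smul, norm_inv, norm_norm, inv_mul_cancel₀ (norm_ne_zero_iff.2 hx.1)]
  have hproj : ∀ x ∈ C, quatToSU2 (‖x‖⁻¹ • x) = quatToSU2 x := fun x hx =>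
    quatToSU2_smul (inv_pos.2 (norm_pos_iff.2 hx.1)) x
  have hmemS : ∀ x ∈ C, quatToSU2 (‖x‖⁻¹ • x) ∈ S := fun x hx => by rw [hproj x hx]; exact hx.2
  have hA : (volume : Measure ℍ) (C ∩ F ⁻¹' (quatToSU2 ⁻¹' N)) = 0 := by
    refine measure_inter_preimage_null_of_coneExt volume hC hC0 hFm (k := k) (k' := fun x => k' (‖x‖⁻¹ • x))
      (fun x hx => ?_) (fun x hx => hk _ (hunit x hx) (hmemS x hx)) (fun x hx => ?_) (fun x hx v hv hv0 => ?_) hN' hvN'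
    · simp only [hF_def]
      rw [hkK _ (hunit x hx) (hmemS x hx), hproj x hx]
    · rw [hkK _ (hunit x hx) (hmemS x hx), norm_su2Quat]
    · refine hinj _ (hunit x hx) (hmemS x hx) v ?_ hv0
      rw [real_inner_smul_left, hv, mul_zero]
  refine measure_mono_null (fun x hx => ?_) (measure_union_null (measure_singleton (0 : ℍ)) hA)
  by_cases hx0 : x = 0
  · exact Or.inl hx0
  refine Or.inr ⟨⟨hx0, hx.2⟩, ?_⟩
  show quatToSU2 (F x) ∈ N
  have hFx : quatToSU2 (F x) = K (quatToSU2 x) := by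
    simp only [hF_def]
    rw [quatToSU2_smul (norm_pos_iff.2 hx0), quatToSU2_su2Quat]
  rw [hFx]
  exact hx.1

/-- The same for the cell's `HaarData.haar` on `SU(2)` (definitionally `haarProbability`). [folklore] -/
theorem haarData_restrict_map_absolutelyContinuous {S : Set (Matrix.specialUnitaryGroup (Fin 2) ℂ)} (hS : IsOpen S)
    {K : Matrix.specialUnitaryGroup (Fin 2) ℂ → Matrix.specialUnitaryGroup (Fin 2) ℂ} (hK : Measurable K)
    {k : ℍ → ℍ} {k' : ℍ → ℍ →L[ℝ] ℍ}
    (hk : ∀ u : ℍ, ‖u‖ = 1 → quatToSU2 u ∈ S → HasStrictFDerivAt k (k' u) u)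
    (hkK : ∀ u : ℍ, ‖u‖ = 1 → quatToSU2 u ∈ S → k u = su2Quat (K (quatToSU2 u)))
    (hinj : ∀ u : ℍ, ‖u‖ = 1 → quatToSU2 u ∈ S → ∀ v : ℍ, ⟪u, v⟫ = 0 → k' u v = 0 → v = 0) :
    ((HaarData.haar : Measure (Matrix.specialUnitaryGroup (Fin 2) ℂ)).restrict S).map K ≪ HaarData.haar :=
  haar_restrict_map_absolutelyContinuous hS hK hk hkK hinj

end SU2

/-! ## 4. `SU(2)`: matrix form of the main theorem -/

section SU2Matrix

open scoped Matrix.Norms.L2Operator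

open Matrix

attribute [local instance] Literature.Analysis.FluidPDE.Tao2016.quatMeasurableSpace
  Literature.Analysis.FluidPDE.Tao2016.quatBorelSpace

attribute [local instance] Literature.MathematicalPhysics.QuantumLattice.secondCountableTopology_su2

/-- The FIRST-ROW READING MAP `M₂(ℂ) → ℍ`, `M ↦ re M₀₀ + im M₀₀ · i + re M₀₁ · j + im M₀₁ · k`, as a continuous real-linear map:
a left inverse of `quatMatrix`, equal to `su2Quat` on `SU(2)`. [folklore] -/
def topRowQuat : Matrix (Fin 2) (Fin 2) ℂ →L[ℝ] ℍ :=
  LinearMap.toContinuousLinearMap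
    { toFun := fun M => ⟨(M 0 0).re, (M 0 0).im, (M 0 1).re, (M 0 1).im⟩
      map_add' := fun M N => by ext <;> simp
      map_smul' := fun c M => by ext <;> simp }

/-- The formula for `topRowQuat`. [folklore] -/
theorem topRowQuat_apply (M : Matrix (Fin 2) (Fin 2) ℂ) :
    topRowQuat M = ⟨(M 0 0).re, (M 0 0).im, (M 0 1).re, (M 0 1).im⟩ := rfl

/-- `topRowQuat` is a left inverse of `quatMatrix`. [folklore] -/
@[simp] theorem topRowQuat_quatMatrix (q : ℍ) : topRowQuat (quatMatrix q) = q := by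
  ext <;> simp [topRowQuat_apply]

/-- On `SU(2)` the reading map is `su2Quat`. [folklore] -/
@[simp] theorem topRowQuat_coe (U : Matrix.specialUnitaryGroup (Fin 2) ℂ) :
    topRowQuat (U : Matrix (Fin 2) (Fin 2) ℂ) = su2Quat U := rfl

/-- `quatMatrix` as a continuous real-linear map `ℍ →L[ℝ] M₂(ℂ)`. [folklore] -/
def quatMatrixCLM : ℍ →L[ℝ] Matrix (Fin 2) (Fin 2) ℂ :=
  LinearMap.toContinuousLinearMap quatMatrixLinear

/-- `quatMatrixCLM` is `quatMatrix`. [folklore] -/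
@[simp] theorem quatMatrixCLM_apply (q : ℍ) : quatMatrixCLM q = quatMatrix q := rfl

/-- TANGENT VECTORS.  For a unit quaternion `u` and `v ⊥ u`, the quaternion `ū v` is purely imaginary, so `X := quatMatrix (ū v)` is
skew-Hermitian and traceless, and `quatMatrix v = quatMatrix u * X` — the tangent vectors of `SU(2)` at `↑(quatToSU2 u) = quatMatrix u`
are exactly the `quatMatrix v`, `v ⊥ u`. [folklore] -/
theorem quatMatrix_tangent {u v : ℍ} (hu : ‖u‖ = 1) (hv : ⟪u, v⟫ = 0) :
    (quatMatrix (star u * v))ᴴ = -quatMatrix (star u * v) ∧ (quatMatrix (star u * v)).trace = 0 ∧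
      quatMatrix v = quatMatrix u * quatMatrix (star u * v) := by
  have hre : (star u * v).re = 0 := by
    have h := Quaternion.inner_def u v
    rw [hv] at h
    simp only [Quaternion.re_mul, Quaternion.re_star, Quaternion.imI_star, Quaternion.imJ_star,
      Quaternion.imK_star] at h ⊢
    linarith
  refine ⟨?_, ?_, ?_⟩
  · rw [← quatMatrix_star, Quaternion.star_eq_neg.2 hre, quatMatrix_neg]
  · rw [Matrix.trace_fin_two, quatMatrix_apply_00, quatMatrix_apply_11]
    apply Complex.ext <;> simp [hre]
  · rw [← quatMatrix_mul, ← mul_assoc, Quaternion.self_mul_star, Quaternion.normSq_eq_norm_mul_self, hu, mul_one,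
      Quaternion.coe_one, one_mul]

/-- RANGE OF THE TANGENT MAP (derived, not assumed).  Let `K♯ : M₂(ℂ) → M₂(ℂ)` have strict derivative `D W` at `↑W` and agree with
`K : SU(2) → SU(2)` at `↑W`, for `W` in an open `S`.  Then at a unit `u` over `S` (`W = quatToSU2 u`) the derivative maps tangent
directions into quaternion matrices: `D W (quatMatrix v) = quatMatrix (topRowQuat (D W (quatMatrix v)))` for `v ⊥ u`.  (Differentiate the
identity `quatMatrix (topRowQuat (Φ y)) = Φ y`, `Φ y := K♯ (quatMatrix (y/‖y‖))`, valid on the open cone over `S`; uniqueness of the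
derivative.) [folklore] -/
theorem apply_quatMatrix_eq_of_tangent {S : Set (Matrix.specialUnitaryGroup (Fin 2) ℂ)} (hS : IsOpen S)
    {K : Matrix.specialUnitaryGroup (Fin 2) ℂ → Matrix.specialUnitaryGroup (Fin 2) ℂ}
    {Kmat : Matrix (Fin 2) (Fin 2) ℂ → Matrix (Fin 2) (Fin 2) ℂ}
    {D : Matrix.specialUnitaryGroup (Fin 2) ℂ → Matrix (Fin 2) (Fin 2) ℂ →L[ℝ] Matrix (Fin 2) (Fin 2) ℂ}
    (hd : ∀ W ∈ S, HasStrictFDerivAt Kmat (D W) (W : Matrix (Fin 2) (Fin 2) ℂ))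
    (hKmat : ∀ W ∈ S, Kmat (W : Matrix (Fin 2) (Fin 2) ℂ) = ((K W : Matrix.specialUnitaryGroup (Fin 2) ℂ) : Matrix (Fin 2) (Fin 2) ℂ))
    {u v : ℍ} (hu : ‖u‖ = 1) (huS : quatToSU2 u ∈ S) (hv : ⟪u, v⟫ = 0) :
    D (quatToSU2 u) (quatMatrix v) = quatMatrix (topRowQuat (D (quatToSU2 u) (quatMatrix v))) := by
  have hu0 : u ≠ 0 := fun h => by rw [h, norm_zero] at hu; exact zero_ne_one hu
  -- the cone over `S` and the map `Φ`
  set C : Set ℍ := {(0 : ℍ)}ᶜ ∩ quatToSU2 ⁻¹' S with hC_def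
  have hC : IsOpen C := isOpen_cone hS
  have huC : u ∈ C := ⟨hu0, huS⟩
  set Φ : ℍ → Matrix (Fin 2) (Fin 2) ℂ := fun y => Kmat (quatMatrix (‖y‖⁻¹ • y)) with hΦ_def
  -- derivative of `Φ` at `u`
  have hrad := hasStrictFDerivAt_radial hu0
  have h1 : HasStrictFDerivAt Kmat (D (quatToSU2 u)) (quatMatrixCLM (‖u‖⁻¹ • u)) := by
    rw [quatMatrixCLM_apply, hu, inv_one, one_smul, ← coe_quatToSU2_of_norm_eq_one hu]
    exact hd _ huS
  have h2 : HasStrictFDerivAt (fun y : ℍ => Kmat (quatMatrixCLM (‖y‖⁻¹ • y)))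
      ((D (quatToSU2 u)).comp (quatMatrixCLM.comp _)) u :=
    HasStrictFDerivAt.comp u (f := fun y : ℍ => quatMatrixCLM (‖y‖⁻¹ • y)) h1
      (HasStrictFDerivAt.comp u (f := fun y : ℍ => ‖y‖⁻¹ • y) quatMatrixCLM.hasStrictFDerivAt hrad)
  have h2' : HasFDerivAt Φ ((D (quatToSU2 u)).comp (quatMatrixCLM.comp _)) u := h2.hasFDerivAt
  -- the identity `quatMatrix ∘ topRowQuat ∘ Φ = Φ` on the cone
  have hid : ∀ y ∈ C, quatMatrixCLM (topRowQuat (Φ y)) = Φ y := by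
    intro y hy
    have hy0 : ‖y‖ ≠ 0 := norm_ne_zero_iff.2 hy.1
    have hy1 : ‖‖y‖⁻¹ • y‖ = 1 := by rw [norm_smul, norm_inv, norm_norm, inv_mul_cancel₀ hy0]
    have hyS : quatToSU2 (‖y‖⁻¹ • y) ∈ S := by
      rw [quatToSU2_smul (inv_pos.2 (norm_pos_iff.2 hy.1))]; exact hy.2
    have hΦy : Φ y = ((K (quatToSU2 (‖y‖⁻¹ • y)) : Matrix.specialUnitaryGroup (Fin 2) ℂ) : Matrix (Fin 2) (Fin 2) ℂ) := by
      simp only [hΦ_def]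
      rw [← coe_quatToSU2_of_norm_eq_one hy1, hKmat _ hyS]
    rw [hΦy, topRowQuat_coe, quatMatrixCLM_apply, quatMatrix_su2Quat]
  have hev : Φ =ᶠ[𝓝 u] fun y => quatMatrixCLM (topRowQuat (Φ y)) :=
    Filter.eventually_of_mem (hC.mem_nhds huC) fun y hy => (hid y hy).symm
  have h3 : HasFDerivAt Φ ((quatMatrixCLM.comp topRowQuat).comp ((D (quatToSU2 u)).comp (quatMatrixCLM.comp _))) u :=
    ((quatMatrixCLM.comp topRowQuat).hasFDerivAt.comp u h2').congr_of_eventuallyEq hev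
  have h4 := congrArg (fun L : ℍ →L[ℝ] Matrix (Fin 2) (Fin 2) ℂ => L v) (h2'.unique h3)
  simp only [ContinuousLinearMap.comp_apply] at h4
  rw [radialDeriv_apply_of_inner_eq_zero hv, hu, inv_one, one_smul] at h4
  simpa only [quatMatrixCLM_apply] using h4

/-- **MAIN THEOREM (matrix form): LEMMA A ON `SU(2)` FOR AN AMBIENT MATRIX MAP.**  Let `S ⊆ SU(2)` be open, `K : SU(2) → SU(2)`
measurable, and `K♯ : M₂(ℂ) → M₂(ℂ)` an ambient map with, for every `W ∈ S`: a strict real Fréchet derivative `D W` at `↑W`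
(`L²`-operator norm on `M₂(ℂ)`), `K♯ ↑W = ↑(K W)`, and TANGENT INJECTIVITY — `D W` kills no non-zero tangent vector `↑W · X`
(`Xᴴ = -X`, `tr X = 0`) of `SU(2)` at `W`.  Then `((Haar).restrict S).map K ≪ Haar`. [folklore] -/
theorem haar_restrict_map_absolutelyContinuous_of_matrix {S : Set (Matrix.specialUnitaryGroup (Fin 2) ℂ)} (hS : IsOpen S)
    {K : Matrix.specialUnitaryGroup (Fin 2) ℂ → Matrix.specialUnitaryGroup (Fin 2) ℂ} (hK : Measurable K)
    {Kmat : Matrix (Fin 2) (Fin 2) ℂ → Matrix (Fin 2) (Fin 2) ℂ}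
    {D : Matrix.specialUnitaryGroup (Fin 2) ℂ → Matrix (Fin 2) (Fin 2) ℂ →L[ℝ] Matrix (Fin 2) (Fin 2) ℂ}
    (hd : ∀ W ∈ S, HasStrictFDerivAt Kmat (D W) (W : Matrix (Fin 2) (Fin 2) ℂ))
    (hKmat : ∀ W ∈ S, Kmat (W : Matrix (Fin 2) (Fin 2) ℂ) = ((K W : Matrix.specialUnitaryGroup (Fin 2) ℂ) : Matrix (Fin 2) (Fin 2) ℂ))
    (hinj : ∀ W ∈ S, ∀ X : Matrix (Fin 2) (Fin 2) ℂ, Xᴴ = -X → X.trace = 0 →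
      D W ((W : Matrix (Fin 2) (Fin 2) ℂ) * X) = 0 → X = 0) :
    ((haarProbability (Matrix.specialUnitaryGroup (Fin 2) ℂ)).restrict S).map K ≪
      haarProbability (Matrix.specialUnitaryGroup (Fin 2) ℂ) := by
  refine haar_restrict_map_absolutelyContinuous hS hK (k := fun q => topRowQuat (Kmat (quatMatrix q)))
    (k' := fun u => topRowQuat.comp ((D (quatToSU2 u)).comp quatMatrixCLM)) (fun u hu huS => ?_) (fun u hu huS => ?_)
    (fun u hu huS v hv hv0 => ?_)
  · -- (i) strict derivative by the chain rule
    have h1 : HasStrictFDerivAt Kmat (D (quatToSU2 u)) (quatMatrixCLM u) := by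
      rw [quatMatrixCLM_apply, ← coe_quatToSU2_of_norm_eq_one hu]
      exact hd _ huS
    exact topRowQuat.hasStrictFDerivAt.comp u
      (HasStrictFDerivAt.comp u (f := fun q : ℍ => quatMatrixCLM q) h1 quatMatrixCLM.hasStrictFDerivAt)
  · -- (ii) agreement with `K` on the unit sphere over `S`
    show topRowQuat (Kmat (quatMatrix u)) = su2Quat (K (quatToSU2 u))
    rw [← coe_quatToSU2_of_norm_eq_one hu, hKmat _ huS, topRowQuat_coe]
  · -- (iii) tangent injectivity
    have hu0 : u ≠ 0 := fun h => by rw [h, norm_zero] at hu; exact zero_ne_one hu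
    obtain ⟨hXh, hXtr, hvX⟩ := quatMatrix_tangent hu hv
    have hrange := apply_quatMatrix_eq_of_tangent hS hd hKmat hu huS hv
    have hv0' : topRowQuat (D (quatToSU2 u) (quatMatrix v)) = 0 := by
      simpa only [ContinuousLinearMap.comp_apply, quatMatrixCLM_apply] using hv0
    rw [hv0', quatMatrix_zero] at hrange
    have hX : quatMatrix (star u * v) = 0 := by
      refine hinj _ huS _ hXh hXtr ?_
      rw [coe_quatToSU2_of_norm_eq_one hu, ← hvX]
      exact hrange
    have hsv : star u * v = 0 := by rw [← topRowQuat_quatMatrix (star u * v), hX, map_zero]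
    calc v = u * (star u * v) := by
          rw [← mul_assoc, Quaternion.self_mul_star, Quaternion.normSq_eq_norm_mul_self, hu, mul_one, Quaternion.coe_one,
            one_mul]
      _ = 0 := by rw [hsv, mul_zero]

/-- The matrix form for the cell's `HaarData.haar`. [folklore] -/
theorem haarData_restrict_map_absolutelyContinuous_of_matrix {S : Set (Matrix.specialUnitaryGroup (Fin 2) ℂ)} (hS : IsOpen S)
    {K : Matrix.specialUnitaryGroup (Fin 2) ℂ → Matrix.specialUnitaryGroup (Fin 2) ℂ} (hK : Measurable K)
    {Kmat : Matrix (Fin 2) (Fin 2) ℂ → Matrix (Fin 2) (Fin 2) ℂ}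
    {D : Matrix.specialUnitaryGroup (Fin 2) ℂ → Matrix (Fin 2) (Fin 2) ℂ →L[ℝ] Matrix (Fin 2) (Fin 2) ℂ}
    (hd : ∀ W ∈ S, HasStrictFDerivAt Kmat (D W) (W : Matrix (Fin 2) (Fin 2) ℂ))
    (hKmat : ∀ W ∈ S, Kmat (W : Matrix (Fin 2) (Fin 2) ℂ) = ((K W : Matrix.specialUnitaryGroup (Fin 2) ℂ) : Matrix (Fin 2) (Fin 2) ℂ))
    (hinj : ∀ W ∈ S, ∀ X : Matrix (Fin 2) (Fin 2) ℂ, Xᴴ = -X → X.trace = 0 →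
      D W ((W : Matrix (Fin 2) (Fin 2) ℂ) * X) = 0 → X = 0) :
    ((HaarData.haar : Measure (Matrix.specialUnitaryGroup (Fin 2) ℂ)).restrict S).map K ≪ HaarData.haar :=
  haar_restrict_map_absolutelyContinuous_of_matrix hS hK hd hKmat hinj

end SU2Matrix

end Literature.MathematicalPhysics.QuantumFieldTheory.Balaban1983to89.T4HaarSU2LocalDiffeo

end
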